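import Mathlib.NumberTheory.Real.Irrational
import Mathlib.LinearAlgebra.Dimension.RankNullity
import Mathlib.LinearAlgebra.FiniteDimensional.Lemmas
import Mathlib.LinearAlgebra.Matrix.Determinant.Basic
import Mathlib.Analysis.SpecificLimits.Basic
import Summits.KontsevichZagierPeriods.Zeta5Search.CriteriaDimension
import HarnessLib

/-!
# ζ(5) search — the TYPE-II DUAL dimension criterion (Marcovecchio 2021, m = 3, l = 2), PROVED
(cell `pub-zeta5`, lane `fam-indep` = linear-independence / dimension; families/indep/FAMILY.md §5.8 (ii))

HONEST FRAMING: systematic search; no irrationality claim unless certified.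

R. Marcovecchio, *Vectors of type II Hermite–Padé approximations and a new linear independence
criterion*, Ann. Mat. Pura Appl. (2021), arXiv:2006.11260, Theorem 2.1, in the first non-trivial
case `m = 3`, `l = 2`: let `1 = v 0, v 1, v 2, v 3` be real numbers and suppose TWO sequences of
simultaneous ("type II") integer approximations `q n ν`, `p μ ν n` (`ν = 0, 1`, `μ = 0, 1, 2`) are given,
with errors `ε μ ν n = q ν n · v (μ+1) − p μ ν n`, such that

* every `2 × 2` minor `ε μ 0 n · ε μ' 1 n − ε μ' 0 n · ε μ 1 n` of the `3 × 2` error matrix tends to `0`;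
* for every integer `2 × 3` matrix `Λ` with linearly independent rows, `det (Λ · ε n) ≠ 0` for
  infinitely many `n`.

Then `dim_ℚ Span_ℚ (v 0, v 1, v 2, v 3) ≥ 2 + m − l = 3`.  The proof is elementary linear algebra
(rank–nullity gives two independent integer relations if the dimension were `≤ 2`; they form a `Λ`
for which `Λ · ε n` is an INTEGER matrix whose determinant tends to `0`, hence vanishes eventually)
and is carried out here in full — this file cites the paper for the STATEMENT only; nothing is
assumed.  With `v = thetaFour = (1, ζ(3), ζ(5), ζ(7))` the landed `zetaFiveOrSeven_of_finrank_three`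
turns such a certificate into "one of `ζ(5), ζ(7)` is irrational" (the cell's T2).  No family of
type-II approximations to three odd zeta values at `z = 1` meeting these hypotheses is known
(FAMILY.md §5.8); the certificate is the typed REQUIREMENT, not a claim.
-/

open Filter Topology Finset

namespace Summit.KontsevichZagierPeriods.Zeta5Search

/-- Error of a type-II (simultaneous) approximation: `ε μ ν n = q ν n · v (μ+1) − p μ ν n`. -/
def typeIIErr (v : Fin 4 → ℝ) (q : Fin 2 → ℕ → ℤ) (p : Fin 3 → Fin 2 → ℕ → ℤ)
    (μ : Fin 3) (ν : Fin 2) (n : ℕ) : ℝ :=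
  (q ν n : ℝ) * v μ.succ - (p μ ν n : ℝ)

/-- The `3 × 2` error matrix `[ε μ ν n]`. -/
def typeIIMat (v : Fin 4 → ℝ) (q : Fin 2 → ℕ → ℤ) (p : Fin 3 → Fin 2 → ℕ → ℤ) (n : ℕ) :
    Matrix (Fin 3) (Fin 2) ℝ :=
  Matrix.of fun μ ν => typeIIErr v q p μ ν n

/-- **Typed certificate** for Marcovecchio's dual criterion with `m = 3`, `l = 2`
(arXiv:2006.11260 Thm 2.1): two sequences of simultaneous integer approximations to
`v 1, v 2, v 3` whose `2 × 2` error minors tend to `0` and which are non-singular against every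
rank-2 integer matrix infinitely often. -/
structure TypeIIDualCertificate (v : Fin 4 → ℝ) where
  /-- the two denominator sequences `q^{(ν)}_n` -/
  q : Fin 2 → ℕ → ℤ
  /-- the numerators `p^{(μ,ν)}_n` -/
  p : Fin 3 → Fin 2 → ℕ → ℤ
  /-- all `2 × 2` minors of the error matrix tend to `0` -/
  minors_tendsto : ∀ μ μ' : Fin 3,
    Tendsto (fun n => typeIIErr v q p μ 0 n * typeIIErr v q p μ' 1 n
      - typeIIErr v q p μ' 0 n * typeIIErr v q p μ 1 n) atTop (𝓝 0)
  /-- non-singularity: for every integer `2 × 3` matrix with independent rows,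
  `det (Λ ε_n) ≠ 0` for infinitely many `n` -/
  nonsingular : ∀ Λ : Matrix (Fin 2) (Fin 3) ℤ, LinearIndependent ℤ ![Λ 0, Λ 1] →
    ∃ᶠ n in atTop, (Λ.map (Int.cast : ℤ → ℝ) * typeIIMat v q p n).det ≠ 0

/-- An integer sequence whose real casts tend to `0` vanishes eventually. -/
theorem eventually_eq_zero_of_tendsto_intCast {d : ℕ → ℤ}
    (h : Tendsto (fun n => (d n : ℝ)) atTop (𝓝 0)) : ∀ᶠ n in atTop, d n = 0 := by
  have h1 : ∀ᶠ n in atTop, dist (d n : ℝ) 0 < 1 := Metric.tendsto_nhds.mp h 1 one_pos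
  filter_upwards [h1] with n hn
  rw [Real.dist_eq, sub_zero] at hn
  exact Int.abs_lt_one_iff.mp (by exact_mod_cast hn)

/-- Clearing denominators of a rational vector: `N • ω` is integral for `N = ∏ den`. -/
theorem exists_nat_mul_eq_int {k : ℕ} (ω : Fin k → ℚ) :
    ∃ N : ℕ, 0 < N ∧ ∃ z : Fin k → ℤ, ∀ i, (N : ℚ) * ω i = z i := by
  refine ⟨∏ j, (ω j).den, Finset.prod_pos fun j _ => (ω j).den_pos,
    fun i => (ω i).num * ∏ j ∈ univ.erase i, ((ω j).den : ℤ), fun i => ?_⟩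
  have hsplit : (∏ j, ((ω j).den : ℚ)) = (∏ j ∈ univ.erase i, ((ω j).den : ℚ)) * (ω i).den := by
    rw [Finset.prod_erase_mul _ _ (Finset.mem_univ i)]
  push_cast
  rw [hsplit, mul_assoc, mul_comm ((ω i).den : ℚ) (ω i), Rat.mul_den_eq_num, mul_comm]

/-- **Marcovecchio's dual criterion, `m = 3`, `l = 2` (arXiv:2006.11260 Thm 2.1), proved.** -/
theorem finrank_three_of_typeII (v : Fin 4 → ℝ) (hv0 : v 0 = 1)
    (C : TypeIIDualCertificate v) :
    3 ≤ Module.finrank ℚ (Submodule.span ℚ (Set.range v)) := by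
  by_contra hlt
  push Not at hlt
  -- the evaluation map `ω ↦ ∑ ω_i v_i` and its kernel (rational relations)
  let f : (Fin 4 → ℚ) →ₗ[ℚ] ℝ := Fintype.linearCombination ℚ v
  have hrange : Module.finrank ℚ (LinearMap.range f) ≤ 2 := by
    have : LinearMap.range f = Submodule.span ℚ (Set.range v) := Fintype.range_linearCombination ℚ v
    rw [this]; omega
  have hrn : Module.finrank ℚ (LinearMap.range f) + Module.finrank ℚ (LinearMap.ker f) = 4 := by
    rw [LinearMap.finrank_range_add_finrank_ker f]; simp
  have hker : 1 < Module.finrank ℚ (LinearMap.ker f) := by omega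
  -- two independent rational relations
  obtain ⟨x, hx⟩ := (Module.finrank_pos_iff_exists_ne_zero (R := ℚ) (M := LinearMap.ker f)).mp
    (by omega)
  obtain ⟨y, hxy⟩ := exists_linearIndependent_pair_of_one_lt_finrank hker hx
  -- relations: f x = 0, f y = 0
  have hfx : ∑ i, (x.1 i : ℝ) * v i = 0 := by
    have := x.2; rw [LinearMap.mem_ker, Fintype.linearCombination_apply] at this
    simpa [Rat.smul_def] using this
  have hfy : ∑ i, (y.1 i : ℝ) * v i = 0 := by
    have := y.2; rw [LinearMap.mem_ker, Fintype.linearCombination_apply] at this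
    simpa [Rat.smul_def] using this
  -- clear denominators
  obtain ⟨Nx, hNx, zx, hzx⟩ := exists_nat_mul_eq_int x.1
  obtain ⟨Ny, hNy, zy, hzy⟩ := exists_nat_mul_eq_int y.1
  have hzxrel : ∑ i, (zx i : ℝ) * v i = 0 := by
    have : ∑ i, (zx i : ℝ) * v i = (Nx : ℝ) * ∑ i, (x.1 i : ℝ) * v i := by
      rw [Finset.mul_sum]; refine Finset.sum_congr rfl fun i _ => ?_
      have := hzx i
      have : ((zx i : ℚ) : ℝ) = ((Nx : ℚ) * x.1 i : ℚ) := by rw [this]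
      push_cast at this; rw [this]; ring
    rw [this, hfx, mul_zero]
  have hzyrel : ∑ i, (zy i : ℝ) * v i = 0 := by
    have : ∑ i, (zy i : ℝ) * v i = (Ny : ℝ) * ∑ i, (y.1 i : ℝ) * v i := by
      rw [Finset.mul_sum]; refine Finset.sum_congr rfl fun i _ => ?_
      have := hzy i
      have : ((zy i : ℚ) : ℝ) = ((Ny : ℚ) * y.1 i : ℚ) := by rw [this]
      push_cast at this; rw [this]; ring
    rw [this, hfy, mul_zero]
  -- the integer matrix Λ of tails
  let Λ : Matrix (Fin 2) (Fin 3) ℤ := Matrix.of fun k μ => (if k = 0 then zx else zy) μ.succ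
  -- its rows are linearly independent over ℤ
  have hΛ : LinearIndependent ℤ ![Λ 0, Λ 1] := by
    rw [LinearIndependent.pair_iff]
    intro s t hst
    -- the combination u = s Nx x + t Ny y has zero tail, hence is zero
    have htail : ∀ μ : Fin 3, (s : ℚ) * (Nx : ℚ) * x.1 μ.succ + (t : ℚ) * (Ny : ℚ) * y.1 μ.succ = 0 := by
      intro μ
      have h := congr_fun hst μ
      simp only [Λ, Matrix.of_apply, Pi.add_apply, Pi.smul_apply, smul_eq_mul, Pi.zero_apply] at h
      have h' : ((s * zx μ.succ + t * zy μ.succ : ℤ) : ℚ) = 0 := by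
        have : s * zx μ.succ + t * zy μ.succ = 0 := by simpa using h
        rw [this]; simp
      push_cast at h'
      rw [← hzx μ.succ, ← hzy μ.succ] at h'
      linarith
    have hhead : (s : ℚ) * (Nx : ℚ) * x.1 0 + (t : ℚ) * (Ny : ℚ) * y.1 0 = 0 := by
      -- use the relations: ∑ u_i v_i = 0 with tail zero and v 0 = 1
      have hu : ∑ i, (((s : ℚ) * Nx * x.1 i + (t : ℚ) * Ny * y.1 i : ℚ) : ℝ) * v i = 0 := by
        have : ∑ i, (((s : ℚ) * Nx * x.1 i + (t : ℚ) * Ny * y.1 i : ℚ) : ℝ) * v i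
            = (s : ℝ) * Nx * ∑ i, (x.1 i : ℝ) * v i + (t : ℝ) * Ny * ∑ i, (y.1 i : ℝ) * v i := by
          rw [Finset.mul_sum, Finset.mul_sum, ← Finset.sum_add_distrib]
          refine Finset.sum_congr rfl fun i _ => ?_
          push_cast; ring
        rw [this, hfx, hfy]; ring
      rw [Fin.sum_univ_succ, hv0, mul_one] at hu
      have htail0 : ∑ μ : Fin 3, (((s : ℚ) * Nx * x.1 μ.succ + (t : ℚ) * Ny * y.1 μ.succ : ℚ) : ℝ)
          * v μ.succ = 0 := Finset.sum_eq_zero fun μ _ => by rw [htail μ]; simp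
      rw [htail0, add_zero] at hu
      exact_mod_cast hu
    -- so u = 0 coordinatewise; independence of x, y over ℚ gives s Nx = 0, t Ny = 0
    have hu0 : ((s : ℚ) * Nx) • x + ((t : ℚ) * Ny) • y = 0 := by
      apply Subtype.ext
      funext i
      simp only [Submodule.coe_add, Submodule.coe_smul, Pi.add_apply, Pi.smul_apply, smul_eq_mul,
        Submodule.coe_zero, Pi.zero_apply]
      refine Fin.cases ?_ (fun μ => ?_) i
      · simpa [mul_assoc] using hhead
      · simpa [mul_assoc] using htail μ
    have hind := (LinearIndependent.pair_iff.mp hxy) _ _ hu0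
    have hNx0 : (Nx : ℚ) ≠ 0 := by exact_mod_cast hNx.ne'
    have hNy0 : (Ny : ℚ) ≠ 0 := by exact_mod_cast hNy.ne'
    constructor
    · have := hind.1; have : (s : ℚ) = 0 := by
        rcases mul_eq_zero.mp this with h | h; exact h; exact absurd h hNx0
      exact_mod_cast this
    · have := hind.2; have : (t : ℚ) = 0 := by
        rcases mul_eq_zero.mp this with h | h; exact h; exact absurd h hNy0
      exact_mod_cast this
  -- Λ ε_n is an integer matrix
  let Z : ℕ → Matrix (Fin 2) (Fin 2) ℤ := fun n => Matrix.of fun k ν =>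
    -(C.q ν n) * (if k = 0 then zx else zy) 0 - ∑ μ : Fin 3, Λ k μ * C.p μ ν n
  have hrow : ∀ k : Fin 2, ∑ μ : Fin 3, ((if k = 0 then zx else zy) μ.succ : ℝ) * v μ.succ
      = -((if k = 0 then zx else zy) 0 : ℝ) := by
    intro k
    have hrel : ∑ i, ((if k = 0 then zx else zy) i : ℝ) * v i = 0 := by
      fin_cases k
      · simpa using hzxrel
      · simpa using hzyrel
    rw [Fin.sum_univ_succ, hv0, mul_one] at hrel
    linarith
  have hZ : ∀ n, Λ.map (Int.cast : ℤ → ℝ) * typeIIMat v C.q C.p n = (Z n).map (Int.cast : ℤ → ℝ) := by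
    intro n
    ext k ν
    simp only [Matrix.mul_apply, Matrix.map_apply, typeIIMat, typeIIErr, Matrix.of_apply, Z, Λ]
    have : ∑ μ : Fin 3, (((if k = 0 then zx else zy) μ.succ : ℤ) : ℝ) *
        ((C.q ν n : ℝ) * v μ.succ - (C.p μ ν n : ℝ))
        = (C.q ν n : ℝ) * ∑ μ : Fin 3, ((if k = 0 then zx else zy) μ.succ : ℝ) * v μ.succ
          - ∑ μ : Fin 3, (((if k = 0 then zx else zy) μ.succ : ℤ) : ℝ) * (C.p μ ν n : ℝ) := by
      rw [Finset.mul_sum, ← Finset.sum_sub_distrib]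
      refine Finset.sum_congr rfl fun μ _ => ?_
      ring
    rw [this, hrow k]
    push_cast
    ring
  -- det (Λ ε_n) → 0 : it is an integer combination of the minors
  have hdet : Tendsto (fun n => (Λ.map (Int.cast : ℤ → ℝ) * typeIIMat v C.q C.p n).det) atTop (𝓝 0) := by
    have hexp : ∀ n, (Λ.map (Int.cast : ℤ → ℝ) * typeIIMat v C.q C.p n).det
        = ∑ μ : Fin 3, ∑ μ' : Fin 3, ((Λ 0 μ : ℝ) * (Λ 1 μ' : ℝ)) *
          (typeIIErr v C.q C.p μ 0 n * typeIIErr v C.q C.p μ' 1 n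
            - typeIIErr v C.q C.p μ' 0 n * typeIIErr v C.q C.p μ 1 n) := by
      intro n
      rw [Matrix.det_fin_two]
      simp only [Matrix.mul_apply, Matrix.map_apply, typeIIMat, Matrix.of_apply, Fin.sum_univ_three,
        Fin.isValue]
      ring
    simp_rw [hexp]
    have h0 : (0 : ℝ) = ∑ μ : Fin 3, ∑ μ' : Fin 3, ((Λ 0 μ : ℝ) * (Λ 1 μ' : ℝ)) * 0 := by simp
    rw [h0]
    refine tendsto_finsetSum _ fun μ _ => tendsto_finsetSum _ fun μ' _ => ?_
    exact (C.minors_tendsto μ μ').const_mul _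
  have hdetZ : Tendsto (fun n => ((Z n).det : ℝ)) atTop (𝓝 0) := by
    refine hdet.congr fun n => ?_
    rw [hZ n, Int.cast_det]
  have hev : ∀ᶠ n in atTop, (Z n).det = 0 := eventually_eq_zero_of_tendsto_intCast hdetZ
  have hfr := C.nonsingular Λ hΛ
  obtain ⟨n, hne, hze⟩ := (hfr.and_eventually hev).exists
  apply hne
  rw [hZ n, ← Int.cast_det, hze, Int.cast_zero]

/-- **T2 from a type-II dual certificate.** A `TypeIIDualCertificate` for
`(1, ζ(3), ζ(5), ζ(7))` would certify that one of `ζ(5), ζ(7)` is irrational.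
(No such certificate is known; this is the typed requirement (ii) of families/indep/FAMILY.md §5.8.) -/
theorem zetaFiveOrSeven_of_typeII (C : TypeIIDualCertificate thetaFour) :
    Irrational (Literature.NumberTheory.Transcendental.zetaValue 5) ∨
      Irrational (Literature.NumberTheory.Transcendental.zetaValue 7) :=
  zetaFiveOrSeven_of_finrank_three (finrank_three_of_typeII thetaFour (by simp [thetaFour]) C)

end Summit.KontsevichZagierPeriods.Zeta5Search
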